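import Literature.Geometry.GeometricMeasureTheory.DeformationCycle
import HarnessLib

/-!
# The cubical retraction of a rectifiable current with finite boundary mass

Support file for the proof of the named fact
`Literature.Geometry.GeometricMeasureTheory.Federer1969_boundaryRectifiability` (Federer's
boundary rectifiability theorem [Federer1969, 4.2.16 (2)]). In Federer's deformation theorem 4.2.9,
a normal current `S` of dimension `m` is pushed onto the `m`-skeleton of a cubical subdivision of
size `ε` by the admissible push-forward `(σ_m ∘ τ_a)_{#v}` of 4.2.2, and
`∂ (σ_m ∘ τ_a)_{#v} S = (σ_m ∘ τ_a)_{#v} ∂S` ("hence (1) holds and ∂P = ∂T − ∂Q = …", p. 344).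
`DeformationCycle.lean` carried this out for CYCLES; here we record the part of 4.2.9 that the
boundary rectifiability theorem needs, for a rectifiable `(k+2)`-current `S` with `𝐌(∂S) < ∞`
(no integrality of the polyhedral chain is claimed — Federer's clause (6) needs `S ∈ 𝐈`):

* `Cubical.admWeight_vσ_succ_le` — the weight of the coarser control `u_{k+2} ∘ τ_a` on a
  `(k+1)`-current is dominated by `ε^{-(k+1)} u_{k+2}^{-(k+2)}` (`u ≤ 1`);
* **`Current.IsRectifiable.exists_skeleton_retract`** — for `k + 2 ≤ n = dim V` there are constants
  `γ, γ'` such that for every `ε > 0` and every `S ∈ 𝓡_{k+2}(V)` with `𝐌(∂S) < ∞` there are currents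
  `Q` ("`(σ_{k+2} ∘ τ_a)_{#v} S`") and `R` with: `Q ∈ 𝓡_{k+2}(V)`, `spt Q ⊆ μ_ε W'_{k+2}`,
  `𝐌(∂Q) ≤ γ 𝐌(∂S)`, `spt ∂Q ⊆ {dist(·, spt ∂S) ≤ 3√n ε}`, `∂S − ∂Q = ∂R`, `𝐌(R) ≤ ε γ' 𝐌(∂S)`.
  Here `∂Q = (σ_{k+2} ∘ τ_a)_{#v} ∂S` (`Current.boundary_admPushLim`), and `∂S − ∂Q = ∂R` is the
  telescoping homotopy formula of `DeformationCycle.lean` for the CYCLE `∂S` through the retractions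
  `σ_{k+2}, …, σ_n = τ_a` and the affine homotopy from `τ_a` to the identity.

So `∂Q → ∂S` weakly with bounded mass and supports as `ε → 0`, while `Q` is a rectifiable current
carried by the flat `(k+2)`-faces of the subdivision: its sphere slices are computable.
Theorems only; no new definitions, no named facts.

## References

* H. Federer, *Geometric Measure Theory*, Springer 1969, 4.2.2, 4.2.6–4.2.9, 4.2.16 (held copy
  `lit book:federernd-geometric-measure-theory`, PDF pp. 334–337, 340–345, 350) [Federer1969].
* B. White, *A new proof of the compactness theorem for integral currents*, Comment. Math. Helv.
  64 (1989), §1.5 p. 210 ("an easy consequence of the deformation theorem") [White1989].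
-/

noncomputable section

open scoped Distributions ENNReal NNReal Topology ContDiff InnerProductSpace RealInnerProductSpace
open MeasureTheory TopologicalSpace Set Filter Metric Function Module

namespace Literature.Geometry.GeometricMeasureTheory

set_option maxSynthPendingDepth 2

namespace Cubical

section Weight

variable {V : Type*} [NormedAddCommGroup V] [InnerProductSpace ℝ V] [FiniteDimensional ℝ V]
  [MeasurableSpace V] [BorelSpace V] {n : ℕ} (b : OrthonormalBasis (Fin n) ℝ V) {ε : ℝ} {a : Fin n → ℝ}

omit [FiniteDimensional ℝ V] [MeasurableSpace V] [BorelSpace V] in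
/-- **The weight of the coarser control.** For the control function `v = u_{k+2} ∘ τ_a` (scaled by
`ε`) and a current of degree `k+1`, `(1/v)^{k+1} ≤ ε^{-(k+1)} u_{k+2}^{-(k+2)}(model x + a)`
wherever `u_{k+2} > 0`, because `u_{k+2} ≤ 1` [Federer1969, 4.2.9: "σ_i ∘ τ_a and ∂T are
w admissible for m − 1 ≤ i ≤ n", the boundary being controlled by a lower power of `u`].
[cite: Federer1969, 4.2.6, 4.2.9] -/
theorem admWeight_vσ_succ_le (hε : 0 < ε) (k : ℕ) {x : V} (hx : 0 < u (k + 1 + 1) (model b ε x + a)) :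
    admWeight (vσ b ε a (k + 1 + 1)) k x ≤
      ENNReal.ofReal (ε⁻¹ ^ (k + 1)) * ENNReal.ofReal (upow (k + 1 + 1) (model b ε x + a)) := by
  unfold admWeight upow
  set u₀ := u (k + 1 + 1) (model b ε x + a) with hu₀
  have hu₀1 : u₀ ≤ 1 := u_le_one _ _
  rw [vσ_eq b hε.ne', ← ENNReal.ofReal_inv_of_pos (mul_pos hε hx),
    ← ENNReal.ofReal_pow (inv_nonneg.2 (by positivity)), mul_inv, mul_pow,
    ← ENNReal.ofReal_mul (by positivity)]
  refine ENNReal.ofReal_le_ofReal (mul_le_mul_of_nonneg_left ?_ (by positivity))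
  exact pow_le_pow_right₀ ((one_le_inv₀ hx).2 hu₀1) (Nat.le_succ _)

omit [FiniteDimensional ℝ V] [BorelSpace V] in
/-- **The weight bound for the boundary after a good translation**: if
`‖T‖{u_{k+2}(model · + a) = 0} = 0` then
`∫ (1/v)^{k+1} d‖T‖ ≤ ε^{-(k+1)} ∫ u_{k+2}^{-(k+2)}(model x + a) d‖T‖(x)` for `v = u_{k+2}^ε ∘ τ_a`.
[cite: Federer1969, 4.2.7, 4.2.9] -/
theorem lintegral_admWeight_vσ_succ_le (hε : 0 < ε) (k : ℕ) (ρ : Measure V)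
    (h0 : ρ {x | u (k + 1 + 1) (model b ε x + a) = 0} = 0) :
    ∫⁻ x, admWeight (vσ b ε a (k + 1 + 1)) k x ∂ρ ≤
      ENNReal.ofReal (ε⁻¹ ^ (k + 1)) * ∫⁻ x, ENNReal.ofReal (upow (k + 1 + 1) (model b ε x + a)) ∂ρ := by
  rw [← lintegral_const_mul' _ _ ENNReal.ofReal_ne_top]
  refine lintegral_mono_ae ?_
  have : ∀ᵐ x ∂ρ, x ∉ {x | u (k + 1 + 1) (model b ε x + a) = 0} := measure_eq_zero_iff_ae_notMem.1 h0
  filter_upwards [this] with x hx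
  exact admWeight_vσ_succ_le b hε k (lt_of_le_of_ne (u_nonneg _ _) (Ne.symm hx))

end Weight

end Cubical

/-! ### The retraction onto the skeleton and its boundary -/

section Retract

open Cubical

variable {V : Type*} [NormedAddCommGroup V] [InnerProductSpace ℝ V] [FiniteDimensional ℝ V]
  [MeasurableSpace V] [BorelSpace V] {n : ℕ}

/-- **The cubical retraction of a rectifiable current with finite boundary mass**
[Federer1969, 4.2.9 for `T ∈ 𝓡_m ∩ 𝐍_m`, the part not involving integrality of `P`]: for
`k + 2 ≤ n = dim V` there are constants `γ, γ' ≥ 0` such that for every `ε > 0` and every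
`S ∈ 𝓡_{k+2}(V)` with `𝐌(∂S) < ∞` there exist a `(k+2)`-current `Q` — the admissible push-forward
`(σ_{k+2} ∘ τ_a)_{#v} S` for a good translation `a` — and a `(k+2)`-current `R` with:
`Q ∈ 𝓡_{k+2}(V)`; `spt Q ⊆ μ_ε W'_{k+2}`; `𝐌(∂Q) ≤ γ 𝐌(∂S)`; `spt ∂Q` within `3√n ε` of `spt ∂S`;
`∂S − ∂Q = ∂R`; `𝐌(R) ≤ ε γ' 𝐌(∂S)`. (`∂Q = (σ_{k+2} ∘ τ_a)_{#v} ∂S` by 4.2.2, and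
`∂S − (σ_{k+2} ∘ τ_a)_{#v} ∂S = ∂[Σᵢ H_v(σᵢ ∘ τ_a, σ_{i+1} ∘ τ_a) ∂S + h_#([0,1] × ∂S)]` by the
homotopy formulae for the cycle `∂S`.) [cite: Federer1969, 4.2.2, 4.2.9] -/
theorem Current.IsRectifiable.exists_skeleton_retract (b : OrthonormalBasis (Fin n) ℝ V) {k : ℕ}
    (hkn : k + 1 + 1 ≤ n) :
    ∃ γ γ' : ℝ, 0 ≤ γ ∧ 0 ≤ γ' ∧ ∀ {ε : ℝ}, 0 < ε →
      ∀ {S : Current (⊤ : Opens V) (k + 1 + 1)}, S.IsRectifiable → S.boundary.mass ≠ ⊤ →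
        ∃ (Q : Current (⊤ : Opens V) (k + 1 + 1)) (R : Current (⊤ : Opens V) (k + 1 + 1)),
          Q.IsRectifiable ∧ Q.support ⊆ skeletonV b (k + 1 + 1) ε ∧
          Q.boundary.mass ≤ ENNReal.ofReal γ * S.boundary.mass ∧
          Q.boundary.support ⊆ cthickening (3 * Real.sqrt n * ε) S.boundary.support ∧
          S.boundary - Q.boundary = R.boundary ∧
          R.mass ≤ ENNReal.ofReal (ε * γ') * S.boundary.mass := by
  classical
  -- the constants
  set γ : ℝ := (64 * (n : ℝ) ^ 2) ^ (k + 1) * (4 * avgConst n (k + 1 + 1) / 2 ^ n) with hγdef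
  have havg := avgConst_nonneg n (k + 1 + 1)
  have hγ : 0 ≤ γ := by rw [hγdef]; positivity
  set γ' : ℝ := 2 * (n : ℝ) ^ 2 * 15 ^ (k + 1) * γ + Real.sqrt n with hγ'def
  have hγ' : 0 ≤ γ' := by rw [hγ'def]; positivity
  refine ⟨γ, γ', hγ, hγ', fun {ε} hε {S} hS hdS => ?_⟩
  /- Step 0: basics. -/
  have hn : 0 < n := by omega
  have hSm : S.mass ≠ ⊤ := hS.mass_ne_top'
  have hsupp : IsCompact S.support := hS.2
  set T : Current (⊤ : Opens V) (k + 1) := S.boundary with hTdef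
  have hTm : T.mass ≠ ⊤ := hdS
  have hTcyc : T.boundary = 0 := S.boundary_boundary
  have hdT : T.boundary.mass ≠ ⊤ := T.boundary_mass_ne_top_of_cycle hTcyc
  have hTsupp : IsCompact T.support := S.isCompact_support_boundary hsupp
  haveI : IsFiniteMeasure S.variation := ⟨lt_of_le_of_lt (S.variation_le_mass _) hSm.lt_top⟩
  haveI : IsFiniteMeasure T.variation := ⟨lt_of_le_of_lt (T.variation_le_mass _) hTm.lt_top⟩
  /- Step 1: a good translation for `‖S‖` and `‖∂S‖`. -/
  set ν : Fin 2 → Measure V := ![S.variation, T.variation] with hν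
  haveI hfinν : ∀ i : Fin 2, IsFiniteMeasure (ν i) := by
    intro i; fin_cases i
    · show IsFiniteMeasure S.variation; infer_instance
    · show IsFiniteMeasure T.variation; infer_instance
  obtain ⟨a, ha, hreg, h1, h2, h3, h4⟩ := exists_good_translateV' b (ε := ε) S.variation T.variation
    (k + 1 + 1) (k + 1 + 1) (ν := ν)
  have hregS : S.variation {x | model b ε x + a ∉ regularSet n} = 0 := hreg 0
  have hregT : T.variation {x | model b ε x + a ∉ regularSet n} = 0 := hreg 1
  /- Step 2: control function, maps, admissibility, weights. -/
  set v : V → ℝ := vσ b ε a (k + 1 + 1) with hvdef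
  have hv : LipschitzWith 1 v := lipschitzWith_vσ b hε (k + 1 + 1)
  have hvε : ∀ x, v x ≤ ε := vσ_le b hε.le (k + 1 + 1)
  set C : ℝ := 8 * n * Real.sqrt n * ε with hCdef
  have hC : 0 ≤ C := by positivity
  set g : ℕ → V → V := fun j => gσ b ε a (k + 1 + 1 + j) with hgdef
  have hadm : ∀ j, Admissible v (g j) C := fun j => admissible_gσ b hε hn (Nat.le_add_right _ _)
  set η₀ : ℝ := 2 * Real.sqrt n * ε with hη₀def
  have hη₀ : 0 ≤ η₀ := by positivity
  have hclose : ∀ j, ∀ x, 0 < v x → ‖g (j + 1) x - g j x‖ ≤ η₀ := fun j x _ => by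
    simp only [hgdef, show k + 1 + 1 + (j + 1) = k + 1 + 1 + j + 1 by ring]
    exact norm_gσ_succ_sub_le b hε _ x
  -- the weight of `S`
  have hISeq := lintegral_admWeight_vσ_eq b hε (k + 1) S.variation h1
  have hISle : ∫⁻ x, admWeight v (k + 1) x ∂S.variation ≤
      ENNReal.ofReal (ε⁻¹ ^ (k + 1 + 1)) * (ENNReal.ofReal (4 * avgConst n (k + 1 + 1) / 2 ^ n) * S.mass) := by
    rw [hvdef, hISeq]
    exact mul_le_mul' le_rfl (h3.trans (mul_le_mul' le_rfl (S.variation_le_mass _)))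
  have hIS : ∫⁻ x, admWeight v (k + 1) x ∂S.variation ≠ ⊤ :=
    ne_top_of_le_ne_top (ENNReal.mul_ne_top ENNReal.ofReal_ne_top
      (ENNReal.mul_ne_top ENNReal.ofReal_ne_top hSm)) hISle
  -- the weight of `T = ∂S`
  have hITle : ∫⁻ x, admWeight v k x ∂T.variation ≤
      ENNReal.ofReal (ε⁻¹ ^ (k + 1)) * (ENNReal.ofReal (4 * avgConst n (k + 1 + 1) / 2 ^ n) * T.mass) := by
    rw [hvdef]
    refine (lintegral_admWeight_vσ_succ_le b hε k T.variation h2).trans ?_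
    exact mul_le_mul' le_rfl (h4.trans (mul_le_mul' le_rfl (T.variation_le_mass _)))
  have hIT : ∫⁻ x, admWeight v k x ∂T.variation ≠ ⊤ :=
    ne_top_of_le_ne_top (ENNReal.mul_ne_top ENNReal.ofReal_ne_top
      (ENNReal.mul_ne_top ENNReal.ofReal_ne_top hTm)) hITle
  /- Step 3: good sequences. -/
  obtain ⟨RS⟩ := S.exists_goodSeq hSm hdS hv hε (P := fun _ => True) (Eventually.of_forall fun _ => trivial)
  obtain ⟨RT⟩ := T.exists_goodSeq hTm hdT hv hε (P := fun _ => True) (Eventually.of_forall fun _ => trivial)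
  /- Step 4: the currents. -/
  set Q : Current (⊤ : Opens V) (k + 1 + 1) :=
    S.admPushLim b hSm hsupp hv.continuous (hadm 0) hC hε RS hvε hIS with hQ
  set N : ℕ := n - (k + 1 + 1) with hN
  have hkN : k + 1 + 1 + N = n := by omega
  set A : ℕ → Current (⊤ : Opens V) (k + 1) := fun j =>
    T.admPushLim b hTm hTsupp hv.continuous (hadm j) hC hε RT hvε hIT with hA
  set SH : ℕ → Current (⊤ : Opens V) (k + 1 + 1) := fun j =>
    T.admHomLim b hTm hTsupp hv.continuous (hadm j) (hadm (j + 1)) hC hη₀ (hclose j) hε RT hvε hIT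
    with hSH
  -- `∂Q = (g₀)_{#v} ∂S`
  have hQbd : Q.boundary = A 0 := by
    simp only [hQ, hA]
    exact S.boundary_admPushLim b hSm hdS hsupp hv (hadm 0) hC hε hvε hIS hIT RS RT
  -- the telescoping homotopy formula for the cycle `T`
  have hstep : ∀ j, A (j + 1) - A j = (SH j).boundary := fun j =>
    T.admPushLim_sub_admPushLim_eq_of_cycle b hTm hTcyc hTsupp hv (hadm j) (hadm (j + 1)) hC hη₀
      (hclose j) hε hvε hIT RT RT RT
  have htel : A N - A 0 = (∑ j ∈ Finset.range N, SH j).boundary := by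
    rw [Current.boundary_finset_sum, ← Finset.sum_range_sub]
    exact Finset.sum_congr rfl fun j _ => hstep j
  -- the last map is the translation
  have hgN : g N = fun x => x + transV b ε a := by
    funext x; simp only [hgdef, hkN]; exact gσ_of_le b hε.ne' le_rfl x
  have hgNlip : LipschitzWith 1 (g N) := by
    rw [hgN]; exact LipschitzWith.of_dist_le_mul fun x y => by simp
  have hgNs : ContDiff ℝ ∞ (g N) := by rw [hgN]; exact contDiff_id.add contDiff_const
  have hAN : A N = T.lipPushforward hTm hdT hTsupp hgNlip ⊤ :=
    T.admPushLim_eq_lipPushforward b hTm hdT hTsupp hv (hadm N) hC hgNlip hε RT hvε hIT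
  -- the affine homotopy from the translation to the identity
  obtain ⟨hUo, hTU, hχ1, hχabs⟩ := T.cutoff_spec hTsupp
  obtain ⟨hVo, h01, hρ1, hρabs, hρ2⟩ := timeCutoff_spec
  set SL : Current (⊤ : Opens V) (k + 1 + 1) :=
    (T.prodInterval 0 1).pushforward ⊤ (TestFunction.tensorCutoff timeCutoff (T.cutoff hTsupp))
      (contDiff_affineHomotopy hgNs contDiff_id) with hSL
  have hlast : T - A N = SL.boundary := by
    have h := T.homotopy_formula_affine (Ω' := (⊤ : Opens V)) (T.cutoff hTsupp) timeCutoff hgNs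
      contDiff_id hUo hTU hχ1 hVo h01 hρ1
    rw [T.pushforward_id (T.cutoff hTsupp) hUo hTU hχ1, hTcyc] at h
    have h0 : ((0 : Current (⊤ : Opens V) k).prodInterval 0 1).pushforward ⊤
        (TestFunction.tensorCutoff timeCutoff (T.cutoff hTsupp))
        (contDiff_affineHomotopy hgNs contDiff_id) = 0 := by
      have : (0 : Current (⊤ : Opens V) k).prodInterval 0 1 = 0 := by
        ext φ; rw [Current.prodInterval_apply]; simp
      rw [this, Current.pushforward_zero]
    rw [h0, add_zero, ← T.lipPushforward_eq_pushforward hTm hdT hTsupp hgNlip hgNs, ← hAN] at h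
    exact h
  /- Step 5: localisation data. -/
  set O : Set V := {x | model b ε (x + transV b ε a) ∈ regularSet n} with hOdef
  have hO : IsOpen O := isOpen_regularV b
  have hOeq : Oᶜ = {x | model b ε x + a ∉ regularSet n} := by
    ext x; simp [hOdef, model_add_transV b hε.ne']
  have hnullS : S.variation Oᶜ = 0 := by rw [hOeq]; exact hregS
  have hgO : ∀ j, ∀ x ∈ O, ContDiffAt ℝ ∞ (g j) x := fun j x hx => contDiffAt_gσ b _ hx
  obtain ⟨ρ, hρ0, hρ⟩ := hsupp.isBounded.subset_closedBall_lt 0 0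
  set δ : ℝ := Real.sqrt n * ε with hδ
  have hδpos : 0 < δ := by rw [hδ]; exact mul_pos (Real.sqrt_pos.2 (by exact_mod_cast hn)) hε
  have hδ0 : 0 ≤ δ := hδpos.le
  -- for `S`
  set B : Set V := thickening δ S.support with hBdef
  have hB : IsOpen B := isOpen_thickening
  have hSB : S.support ⊆ B := self_subset_thickening hδpos _
  set K : Set V := closedBall (0 : V) (ρ + 3 * δ) with hKdef
  have hK : IsCompact K := isCompact_closedBall _ _
  have hgdist : ∀ j x, dist (g j x) x ≤ 2 * δ := fun j x => by
    rw [hδ]; have := dist_gσ_self_le b hε ha (k + 1 + 1 + j) x; linarith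
  have hBK : ∀ {x y : V}, x ∈ B → dist y x ≤ 2 * δ → y ∈ K := by
    intro x y hx hyx
    obtain ⟨z, hz, hxz⟩ := mem_thickening_iff.1 hx
    rw [hKdef, mem_closedBall, dist_zero_right]
    have hz' : ‖z‖ ≤ ρ := mem_closedBall_zero_iff.1 (hρ hz)
    calc ‖y‖ = dist y 0 := (dist_zero_right _).symm
      _ ≤ dist y x + (dist x z + dist z 0) :=
          (dist_triangle _ _ _).trans (add_le_add le_rfl (dist_triangle _ _ _))
      _ ≤ 2 * δ + (δ + ρ) := add_le_add hyx (add_le_add hxz.le (by rwa [dist_zero_right]))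
      _ = ρ + 3 * δ := by ring
  have hgK : ∀ j, Set.MapsTo (g j) ({x | 0 < v x} ∩ B) K := fun j x hx => hBK hx.2 (hgdist j x)
  -- for `T = ∂S`
  set B' : Set V := thickening δ T.support with hB'def
  have hB' : IsOpen B' := isOpen_thickening
  have hTB' : T.support ⊆ B' := self_subset_thickening hδpos _
  set Z : Set V := cthickening (3 * Real.sqrt n * ε) T.support with hZdef
  have hZc : IsClosed Z := isClosed_cthickening
  have hBZ : ∀ {x y : V}, x ∈ B' → dist y x ≤ 2 * δ → y ∈ Z := by
    intro x y hx hyx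
    obtain ⟨z, hz, hxz⟩ := mem_thickening_iff.1 hx
    refine mem_cthickening_of_dist_le y z _ _ hz ?_
    calc dist y z ≤ dist y x + dist x z := dist_triangle _ _ _
      _ ≤ 2 * δ + δ := add_le_add hyx hxz.le
      _ = 3 * Real.sqrt n * ε := by rw [hδ]; ring
  have hgZ : ∀ j, Set.MapsTo (g j) ({x | 0 < v x} ∩ B') Z := fun j x hx => hBZ hx.2 (hgdist j x)
  /- Step 6: rectifiability and supports. -/
  have hQr : Q.IsRectifiable :=
    hS.admPushLim b hSm hsupp hv.continuous (hadm 0) hC hε RS hvε hIS hO (hgO 0) hnullS hB hSB hK (hgK 0)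
  have hQskel : Q.support ⊆ skeletonV b (k + 1 + 1) ε := by
    refine S.support_admPushLim_subset b hSm hsupp hv.continuous (hadm 0) hC hε RS hvε hIS
      (isClosed_skeletonV b) fun x hx => ?_
    simp only [hgdef, add_zero]
    exact gσ_mem_skeletonV b hε le_rfl hx
  have hA0Z : (A 0).support ⊆ Z := by
    show ((T.admFamily b hTm hTsupp hv.continuous (hadm 0) hC).lim hε RT hvε hIT).support ⊆ Z
    exact (T.admFamily b hTm hTsupp hv.continuous (hadm 0) hC).support_lim_subset hε RT hIT hvε hZc
      fun j => T.support_admPush_subset' b hTm hTsupp hv.continuous (hadm 0) hC (RT.pos hε j) (RT.good j)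
        hB' hTB' hZc (hgZ 0)
  /- Step 7: masses. -/
  have hsqrt : Real.sqrt n * Real.sqrt n = n := Real.mul_self_sqrt (Nat.cast_nonneg n)
  have hconstP : admConst n C k * (ENNReal.ofReal (ε⁻¹ ^ (k + 1)) *
      ENNReal.ofReal (4 * avgConst n (k + 1 + 1) / 2 ^ n)) = ENNReal.ofReal γ := by
    unfold admConst
    rw [hγdef, ← ENNReal.ofReal_pow (by positivity), ← ENNReal.ofReal_mul (by positivity),
      ← ENNReal.ofReal_mul (by positivity)]
    congr 1
    have hεk : (ε * ε⁻¹) ^ (k + 1) = 1 := by rw [mul_inv_cancel₀ hε.ne', one_pow]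
    calc (8 * C * Real.sqrt n) ^ (k + 1) * (ε⁻¹ ^ (k + 1) * (4 * avgConst n (k + 1 + 1) / 2 ^ n))
        = (8 * (8 * n * Real.sqrt n * ε) * Real.sqrt n * ε⁻¹) ^ (k + 1) *
            (4 * avgConst n (k + 1 + 1) / 2 ^ n) := by
          rw [hCdef, ← mul_assoc, ← mul_pow]
      _ = (64 * (n : ℝ) ^ 2 * (ε * ε⁻¹)) ^ (k + 1) * (4 * avgConst n (k + 1 + 1) / 2 ^ n) := by
          congr 2
          calc 8 * (8 * n * Real.sqrt n * ε) * Real.sqrt n * ε⁻¹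
              = 64 * n * (Real.sqrt n * Real.sqrt n) * (ε * ε⁻¹) := by ring
            _ = 64 * (n : ℝ) ^ 2 * (ε * ε⁻¹) := by rw [hsqrt]; ring
      _ = (64 * (n : ℝ) ^ 2) ^ (k + 1) * (4 * avgConst n (k + 1 + 1) / 2 ^ n) := by
          rw [mul_pow, hεk, mul_one]
  have hmassA : (A 0).mass ≤ ENNReal.ofReal γ * T.mass := by
    refine (T.mass_admPushLim_le b hTm hTsupp hv.continuous (hadm 0) hC hε RT hvε hIT).trans ?_
    rw [← hconstP, mul_assoc]
    refine mul_le_mul' le_rfl ?_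
    simpa only [mul_assoc] using hITle
  have hmassSH : ∀ j, (SH j).mass ≤ ENNReal.ofReal (ε * (2 * n * 15 ^ (k + 1) * γ)) * T.mass := by
    intro j
    refine (T.mass_admHomLim_le b hTm hTsupp hv.continuous (hadm j) (hadm (j + 1)) hC hη₀ (hclose j) hε
      RT hvε hIT).trans ?_
    unfold admHomConst
    calc ENNReal.ofReal (Real.sqrt n * η₀) * 15 ^ (k + 1) * admConst n C k *
          ∫⁻ x, admWeight v k x ∂T.variation
        ≤ ENNReal.ofReal (Real.sqrt n * η₀) * 15 ^ (k + 1) * admConst n C k *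
            (ENNReal.ofReal (ε⁻¹ ^ (k + 1)) * (ENNReal.ofReal (4 * avgConst n (k + 1 + 1) / 2 ^ n) *
              T.mass)) := mul_le_mul' le_rfl hITle
      _ = ENNReal.ofReal (Real.sqrt n * η₀) * 15 ^ (k + 1) * (admConst n C k *
            (ENNReal.ofReal (ε⁻¹ ^ (k + 1)) * ENNReal.ofReal (4 * avgConst n (k + 1 + 1) / 2 ^ n))) *
              T.mass := by ring
      _ = ENNReal.ofReal (ε * (2 * n * 15 ^ (k + 1) * γ)) * T.mass := by
          rw [hconstP]
          congr 1
          rw [show (15 : ℝ≥0∞) ^ (k + 1) = ENNReal.ofReal (15 ^ (k + 1)) by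
              rw [ENNReal.ofReal_pow (by norm_num)]; norm_num,
            ← ENNReal.ofReal_mul (by positivity), ← ENNReal.ofReal_mul (by positivity)]
          congr 1
          rw [hη₀def]
          calc Real.sqrt n * (2 * Real.sqrt n * ε) * 15 ^ (k + 1) * γ
              = 2 * (Real.sqrt n * Real.sqrt n) * ε * 15 ^ (k + 1) * γ := by ring
            _ = ε * (2 * n * 15 ^ (k + 1) * γ) := by rw [hsqrt]; ring
  have haV : ‖transV b ε a‖ ≤ δ := norm_transV_le b hε.le ha
  have hmassSL : SL.mass ≤ ENNReal.ofReal (Real.sqrt n * ε) * T.mass := by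
    refine T.mass_affineHomotopy_le _ _ hgNs contDiff_id (by positivity) hρabs fun t _ x _ => ?_
    have hD : fderiv ℝ (g N) x = ContinuousLinearMap.id ℝ V := by
      rw [hgN]; rw [fderiv_add_const]; exact fderiv_id
    rw [hD, fderiv_id, sub_self, smul_zero, add_zero]
    have h1 : ‖(ContinuousLinearMap.id ℝ V : V →L[ℝ] V)‖ ^ (k + 1) ≤ 1 :=
      pow_le_one₀ (norm_nonneg _) ContinuousLinearMap.norm_id_le
    have h2 : ‖id x - g N x‖ ≤ δ := by
      rw [hgN]; simp only [id_eq, sub_add_cancel_left, norm_neg]; exact haV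
    calc |T.cutoff hTsupp x| * ‖id x - g N x‖ * ‖(ContinuousLinearMap.id ℝ V : V →L[ℝ] V)‖ ^ (k + 1)
        ≤ 1 * δ * 1 := mul_le_mul (mul_le_mul (hχabs x) h2 (norm_nonneg _) zero_le_one) h1
          (by positivity) (by positivity)
      _ = Real.sqrt n * ε := by rw [hδ]; ring
  /- Step 8: conclusion. -/
  refine ⟨Q, SL + ∑ j ∈ Finset.range N, SH j, hQr, hQskel, ?_, ?_, ?_, ?_⟩
  · rw [hQbd]; exact hmassA
  · rw [hQbd]; exact hA0Z
  · -- `∂S − ∂Q = ∂R`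
    rw [hQbd, Current.boundary_add, ← htel, ← hlast]; abel
  · -- mass of `R`
    have hN' : (N : ℝ) ≤ n := by exact_mod_cast (Nat.sub_le n (k + 1 + 1))
    calc (SL + ∑ j ∈ Finset.range N, SH j).mass
        ≤ SL.mass + (∑ j ∈ Finset.range N, SH j).mass := Current.mass_add_le _ _
      _ ≤ ENNReal.ofReal (Real.sqrt n * ε) * T.mass +
          ∑ j ∈ Finset.range N, ENNReal.ofReal (ε * (2 * n * 15 ^ (k + 1) * γ)) * T.mass :=
          add_le_add hmassSL ((Current.mass_finset_sum_le SH N).trans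
            (Finset.sum_le_sum fun j _ => hmassSH j))
      _ = (ENNReal.ofReal (Real.sqrt n * ε) +
            (N : ℝ≥0∞) * ENNReal.ofReal (ε * (2 * n * 15 ^ (k + 1) * γ))) * T.mass := by
          rw [Finset.sum_const, Finset.card_range, nsmul_eq_mul, add_mul, mul_assoc]
          ring
      _ ≤ ENNReal.ofReal (ε * γ') * T.mass := by
          refine mul_le_mul' ?_ le_rfl
          rw [show (N : ℝ≥0∞) = ENNReal.ofReal (N : ℝ) by rw [ENNReal.ofReal_natCast],
            ← ENNReal.ofReal_mul (Nat.cast_nonneg N),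
            ← ENNReal.ofReal_add (by positivity) (by positivity)]
          refine ENNReal.ofReal_le_ofReal ?_
          rw [hγ'def]
          have h15 : (0 : ℝ) ≤ 15 ^ (k + 1) := by positivity
          nlinarith [mul_nonneg (mul_nonneg (mul_nonneg hε.le (by positivity : (0:ℝ) ≤ 2 * n)) h15) hγ,
            Real.sqrt_nonneg n]

end Retract

end Literature.Geometry.GeometricMeasureTheory
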